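import Mathlib
import HarnessLib
import Summits.CriticalPhenomena.PercolationContinuityZ3.Theses.PercTreeValue
import Summits.CriticalPhenomena.PercolationContinuityZ3.Theorems.PercTreeValueTetrahedronHarrisGapStubCondHarris
import Summits.CriticalPhenomena.PercolationContinuityZ3.Theorems.PercTreeValueTetrahedronHarrisGapStubCap
import Summits.CriticalPhenomena.PercolationContinuityZ3.Theorems.PercTreeValueTetrahedronHarrisGapStubCovSlicing
import Summits.CriticalPhenomena.PercolationContinuityZ3.Theorems.PercTreeValueTetrahedronHarrisGapStubG
import Summits.CriticalPhenomena.PercolationContinuityZ3.Theorems.PercTreeValueTetrahedronHarrisGapReduction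
import Literature.Probability.Percolation.BlockResampling
import Literature.Probability.Percolation.InfiniteClusterDensity
import Literature.Probability.Percolation.TwoPointFunction
import Literature.Probability.Percolation.CriticalContinuityProofs

/-!
# Crux `TetrahedronHarrisGap` (stmt-CriticalPhenomena-7799), line `SketchIdeator1` rev 5:
# monotonicity of the reshape (`stub_G ∧ stub_block ∧ stub_fatGap ⟹ stub_coherence`)

Line `SketchIdeator1` (card `corner-ball-total-covariance`; skeleton `Cruxes/TetrahedronHarrisGap/Lines/SketchIdeator1.lean`,
rev 5, lead prover-line-stmt-CriticalPhenomena-7799-c1-0).  This file lands the registered stub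
`stub_coherence_of_cornerBallInputs` of the crux item: the three OPEN inputs of revs 1–4 —

* gluing-lite `stub_G` (ONE pair: `c₀ · P_{p_c}(boxArm (r/8+1) 0)² ≤ τ_{p_c}(0, a_r)`; the second pair is automatic,
  `stub_G_of_first` / `tau_opposite_edge_eq`),
* blocking `stub_block` (`P(f_r = 0), P(g_r = 0) ≥ c_B`),
* the relative level-set gap `stub_fatGap` (`Cov(1_{s<f_r}, 1_{t<g_r}) ≥ δ' P(s<f_r) P(t<g_r)` at two-sided `κ`-fat levels),

imply the single rev-5 input `stub_coherence` (`c · Var f_r ≤ Cov(f_r, g_r)`, with `c = δ' c₀⁴ / 256` for the `δ'` of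
`stub_fatGap` at `κ = min (c₀/2) c_B`).  Here `f_r = P(0 ↔ a_r | ω off K_r)`, `g_r = P(b_r ↔ c_r | ω off K_r)`
(`blockCondProb`, BlockResampling.lean), `K_r` = the lattice edges touching the four corner boxes of sup-radius `r/8`.

Proof = the rev-4 composition `crux_of_open_stubs` (`…Reduction.lean`) up to its covariance step,
`Cov(f,g) ≥ δ'(∫_W P(f>s))(∫_W P(g>t)) ≥ δ'(c₀²π²/16)²` (`stub_covSlicing` on the window `W = [c₀π²/8, c₀π²/4]`, whose
levels are `min(c₀/2,c_B)`-fat by the hook cap `stub_cap` + G + Markov and by blocking), followed by the variance cap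
`Var f ≤ ∫ f² ≤ π² ∫ f = π² τ ≤ π⁴` (`f ≤ π²` a.e., `stub_cap`; `π² = P(boxArm (r/8+1) 0)²`).  No new definitions;
sorry-free; the three inputs are HYPOTHESES (a monotonicity statement between reductions, not a proof of the crux).
-/

noncomputable section

open MeasureTheory Filter Set
open Literature.Probability.Percolation Literature.Probability.LatticeModels

namespace Summit.CriticalPhenomena.PercolationContinuityZ3.Theorems.TetrahedronHarrisGap

open CornerBall

/-- **stub_coherence_of_cornerBallInputs** (registered stub of stmt-CriticalPhenomena-7799, line `SketchIdeator1` rev 5;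
MONOTONICITY OF THE RESHAPE). The three open inputs of revs 1–4 — gluing-lite `stub_G` (one pair), blocking `stub_block`,
and the relative level-set gap `stub_fatGap` — imply `stub_coherence` with `c = δ' c₀⁴ / 256`: the rev-4 composition
bounds `Cov(f_r, g_r) ≥ δ'(c₀² π_r²/16)²` (`stub_covSlicing` on the window `[c₀π_r²/8, c₀π_r²/4]`), while the hook cap
`f_r ≤ π_r²` (`stub_cap`) gives `Var f_r ≤ ∫ f_r² ≤ π_r² τ ≤ π_r⁴`.  Hypotheses and conclusion are the stub texts with
`K`, `f`, `g` `let`-bound (definitionally the registered signatures). -/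
theorem stub_coherence_of_cornerBallInputs :
    (∃ c₀ : ℝ, 0 < c₀ ∧ ∃ r₀ : ℕ, ∀ r : ℕ, r₀ ≤ r →
      c₀ * (bondPercolation (zdGraph 3) (criticalProbI 3)).real (boxArm (r / 8 + 1) (0 : Site 3)) ^ 2 ≤
        tau 3 (criticalProbI 3) 0 ![(r : ℤ), (r : ℤ), 0]) →
    (∃ c_B : ℝ, 0 < c_B ∧ ∃ r₀ : ℕ, ∀ r : ℕ, r₀ ≤ r →
      let K : Finset (Sym2 (Site 3)) :=
        armEdges (r / 8) (0 : Site 3) ∪ armEdges (r / 8) ![(r : ℤ), (r : ℤ), 0] ∪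
          armEdges (r / 8) ![(r : ℤ), 0, (r : ℤ)] ∪ armEdges (r / 8) ![0, (r : ℤ), (r : ℤ)];
      let f : BondConfig (Site 3) → ℝ :=
        blockCondProb (zdGraph 3) (criticalProbI 3) K (openConn (0 : Site 3) ![(r : ℤ), (r : ℤ), 0]);
      let g : BondConfig (Site 3) → ℝ :=
        blockCondProb (zdGraph 3) (criticalProbI 3) K (openConn ![(r : ℤ), 0, (r : ℤ)] ![0, (r : ℤ), (r : ℤ)]);
      c_B ≤ (bondPercolation (zdGraph 3) (criticalProbI 3)).real {ω | f ω = 0} ∧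
        c_B ≤ (bondPercolation (zdGraph 3) (criticalProbI 3)).real {ω | g ω = 0}) →
    (∀ κ : ℝ, 0 < κ → ∃ δ' : ℝ, 0 < δ' ∧ ∃ r₀ : ℕ, ∀ r : ℕ, r₀ ≤ r →
      let K : Finset (Sym2 (Site 3)) :=
        armEdges (r / 8) (0 : Site 3) ∪ armEdges (r / 8) ![(r : ℤ), (r : ℤ), 0] ∪
          armEdges (r / 8) ![(r : ℤ), 0, (r : ℤ)] ∪ armEdges (r / 8) ![0, (r : ℤ), (r : ℤ)];
      let f : BondConfig (Site 3) → ℝ :=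
        blockCondProb (zdGraph 3) (criticalProbI 3) K (openConn (0 : Site 3) ![(r : ℤ), (r : ℤ), 0]);
      let g : BondConfig (Site 3) → ℝ :=
        blockCondProb (zdGraph 3) (criticalProbI 3) K (openConn ![(r : ℤ), 0, (r : ℤ)] ![0, (r : ℤ), (r : ℤ)]);
      ∀ s t : ℝ,
      κ ≤ (bondPercolation (zdGraph 3) (criticalProbI 3)).real {ω | s < f ω} →
      (bondPercolation (zdGraph 3) (criticalProbI 3)).real {ω | s < f ω} ≤ 1 - κ →
      κ ≤ (bondPercolation (zdGraph 3) (criticalProbI 3)).real {ω | t < g ω} →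
      (bondPercolation (zdGraph 3) (criticalProbI 3)).real {ω | t < g ω} ≤ 1 - κ →
      δ' * ((bondPercolation (zdGraph 3) (criticalProbI 3)).real {ω | s < f ω} *
          (bondPercolation (zdGraph 3) (criticalProbI 3)).real {ω | t < g ω}) ≤
        (bondPercolation (zdGraph 3) (criticalProbI 3)).real ({ω | s < f ω} ∩ {ω | t < g ω}) -
          (bondPercolation (zdGraph 3) (criticalProbI 3)).real {ω | s < f ω} *
            (bondPercolation (zdGraph 3) (criticalProbI 3)).real {ω | t < g ω}) →
    (∃ c : ℝ, 0 < c ∧ ∃ r₀ : ℕ, ∀ r : ℕ, r₀ ≤ r →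
      let K : Finset (Sym2 (Site 3)) :=
        armEdges (r / 8) (0 : Site 3) ∪ armEdges (r / 8) ![(r : ℤ), (r : ℤ), 0] ∪
          armEdges (r / 8) ![(r : ℤ), 0, (r : ℤ)] ∪ armEdges (r / 8) ![0, (r : ℤ), (r : ℤ)];
      let f : BondConfig (Site 3) → ℝ :=
        blockCondProb (zdGraph 3) (criticalProbI 3) K (openConn (0 : Site 3) ![(r : ℤ), (r : ℤ), 0]);
      let g : BondConfig (Site 3) → ℝ :=
        blockCondProb (zdGraph 3) (criticalProbI 3) K (openConn ![(r : ℤ), 0, (r : ℤ)] ![0, (r : ℤ), (r : ℤ)]);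
      c * (∫ ω, f ω ^ 2 ∂(bondPercolation (zdGraph 3) (criticalProbI 3)) -
            (∫ ω, f ω ∂(bondPercolation (zdGraph 3) (criticalProbI 3))) ^ 2) ≤
        ∫ ω, f ω * g ω ∂(bondPercolation (zdGraph 3) (criticalProbI 3)) -
          (∫ ω, f ω ∂(bondPercolation (zdGraph 3) (criticalProbI 3))) *
            (∫ ω, g ω ∂(bondPercolation (zdGraph 3) (criticalProbI 3)))) := by
  intro hG₁ hBl hFG
  classical
  -- gluing-lite for one pair gives it for both pairs (`tau_opposite_edge_eq`)
  obtain ⟨c₀, hc₀, r₁, hG⟩ := stub_G_of_first hG₁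
  obtain ⟨cB, hcB, r₂, hBl⟩ := hBl
  -- the fatness parameter and the relative gap it buys
  have hκ : 0 < min (c₀ / 2) cB := lt_min (by linarith) hcB
  obtain ⟨δ', hδ', r₃, hFG⟩ := hFG (min (c₀ / 2) cB) hκ
  refine ⟨δ' * c₀ ^ 4 / 256, by positivity, max (max 16 r₁) (max r₂ r₃), fun r hr => ?_⟩
  have h16 : 16 ≤ r := le_trans (le_trans (le_max_left _ _) (le_max_left _ _)) hr
  have hr₁ : r₁ ≤ r := le_trans (le_trans (le_max_right _ _) (le_max_left _ _)) hr
  have hr₂ : r₂ ≤ r := le_trans (le_trans (le_max_left _ _) (le_max_right _ _)) hr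
  have hr₃ : r₃ ≤ r := le_trans (le_trans (le_max_right _ _) (le_max_right _ _)) hr
  -- specialise everything to this `r`
  have hG' := hG r hr₁
  have hBl' := hBl r hr₂
  have hFG' := hFG r hr₃
  have hCap' := stub_cap (criticalProbI 3) r h16
  dsimp only at hBl' hFG' ⊢
  clear hG hBl hFG
  -- names
  set P : Measure (BondConfig (Site 3)) := bondPercolation (zdGraph 3) (criticalProbI 3) with hP
  set K : Finset (Sym2 (Site 3)) :=
    armEdges (r / 8) (0 : Site 3) ∪ armEdges (r / 8) ![(r : ℤ), (r : ℤ), 0] ∪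
      armEdges (r / 8) ![(r : ℤ), 0, (r : ℤ)] ∪ armEdges (r / 8) ![0, (r : ℤ), (r : ℤ)] with hK
  set A : Set (BondConfig (Site 3)) := openConn (0 : Site 3) ![(r : ℤ), (r : ℤ), 0] with hA
  set B : Set (BondConfig (Site 3)) := openConn ![(r : ℤ), 0, (r : ℤ)] ![0, (r : ℤ), (r : ℤ)] with hB
  set f : BondConfig (Site 3) → ℝ := blockCondProb (zdGraph 3) (criticalProbI 3) K A with hf
  set g : BondConfig (Site 3) → ℝ := blockCondProb (zdGraph 3) (criticalProbI 3) K B with hg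
  set π2 : ℝ := P.real (boxArm (r / 8 + 1) (0 : Site 3)) ^ 2 with hπ2
  -- basic facts about `A`, `B`, `f`, `g`
  have hAm : MeasurableSet A := measurableSet_openConn_holds _ _
  have hBm : MeasurableSet B := measurableSet_openConn_holds _ _
  have hAu : IsUpperSet A := isUpperSet_openConn _ _
  have hBu : IsUpperSet B := isUpperSet_openConn _ _
  have hfm : Measurable f := measurable_blockCondProb _ _ K hAm
  have hgm : Measurable g := measurable_blockCondProb _ _ K hBm
  have hf01 : ∀ ω, f ω ∈ Set.Icc (0 : ℝ) 1 := fun ω =>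
    ⟨blockCondProb_nonneg _ _ K A ω, blockCondProb_le_one _ _ K A ω⟩
  have hg01 : ∀ ω, g ω ∈ Set.Icc (0 : ℝ) 1 := fun ω =>
    ⟨blockCondProb_nonneg _ _ K B ω, blockCondProb_le_one _ _ K B ω⟩
  have hfi : Integrable f P :=
    integrable_blockCondProb _ _ K hAm
  have hgi : Integrable g P :=
    integrable_blockCondProb _ _ K hBm
  have hf2i : Integrable (fun ω => f ω ^ 2) P := by
    refine Integrable.of_bound (hfm.pow_const 2).aestronglyMeasurable 1 (ae_of_all _ fun ω => ?_)
    rw [Real.norm_eq_abs, abs_of_nonneg (sq_nonneg _)]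
    nlinarith [(hf01 ω).1, (hf01 ω).2]
  -- the two-point functions are the means of `f`, `g`
  have hτA : tau 3 (criticalProbI 3) 0 ![(r : ℤ), (r : ℤ), 0] = ∫ ω, f ω ∂P := by
    rw [tau_def, hf, integral_blockCondProb_eq _ _ K hAm]
  have hτB : tau 3 (criticalProbI 3) ![(r : ℤ), 0, (r : ℤ)] ![0, (r : ℤ), (r : ℤ)] = ∫ ω, g ω ∂P := by
    rw [tau_def, hg, integral_blockCondProb_eq _ _ K hBm]
  have hpc : 0 < ((criticalProbI 3 : unitInterval) : ℝ) := by
    rw [coe_criticalProbI]; exact (Grimmett1999_criticalProb_pos_lt_one_holds 3 (by norm_num)).1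
  have hτApos : 0 < tau 3 (criticalProbI 3) 0 ![(r : ℤ), (r : ℤ), 0] :=
    tau_pos zdGraph_preconnected_holds _ hpc _ _
  -- a.e. the configuration lives on the lattice, so the cap holds a.e.
  have hae : ∀ᵐ ω ∂P, ω ⊆ (zdGraph 3).edgeSet := by
    rw [hP, bondPercolation]
    exact ProbabilityTheory.setBernoulli_ae_subset
  have hcapf : ∀ᵐ ω ∂P, f ω ≤ π2 := hae.mono fun ω hω => (hCap' ω hω).1
  have hcapg : ∀ᵐ ω ∂P, g ω ≤ π2 := hae.mono fun ω hω => (hCap' ω hω).2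
  -- hence `τ ≤ π2`
  have hτAle : tau 3 (criticalProbI 3) 0 ![(r : ℤ), (r : ℤ), 0] ≤ π2 := by
    rw [hτA]
    calc ∫ ω, f ω ∂P ≤ ∫ _, π2 ∂P := integral_mono_ae hfi (integrable_const _) hcapf
      _ = π2 := by rw [integral_const, probReal_univ, one_smul]
  have hπ2pos : 0 < π2 := lt_of_lt_of_le hτApos hτAle
  have hc₀π2 : c₀ * π2 ≤ 1 := le_trans hG'.1 (tau_le_one _ _ _)
  -- the window `W = [u, v]`, `u = c₀ π2 / 8`, `v = c₀ π2 / 4`, and the Markov level `w = c₀ π2 / 2`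
  set u : ℝ := c₀ * π2 / 8 with hu
  set v : ℝ := c₀ * π2 / 4 with hv
  set w : ℝ := c₀ * π2 / 2 with hw
  have hu0 : 0 < u := by positivity
  have huv : u ≤ v := by rw [hu, hv]; linarith [mul_pos hc₀ hπ2pos]
  have hvw : v < w := by rw [hv, hw]; linarith [mul_pos hc₀ hπ2pos]
  have hv1 : v ≤ 1 := by rw [hv]; linarith
  have hw0 : 0 ≤ w := by positivity
  -- lower fatness: `P(w ≤ f) ≥ c₀/2` by Markov, hence `P(s < f) ≥ c₀/2` for `s ≤ v`
  have hfatf : ∀ s, s ≤ v → c₀ / 2 ≤ P.real {ω | s < f ω} := by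
    intro s hs
    have hM := integral_le_add_mul_measureReal_le P hfm hfi hw0 hcapf
    rw [← hτA] at hM
    have h1 : c₀ * π2 - w ≤ π2 * P.real {ω | w ≤ f ω} := by linarith [hG'.1]
    have h2 : c₀ / 2 * π2 ≤ π2 * P.real {ω | w ≤ f ω} := by rw [hw] at h1; linarith
    have h3 : c₀ / 2 ≤ P.real {ω | w ≤ f ω} := by
      by_contra hlt
      push Not at hlt
      have := mul_lt_mul_of_pos_left hlt hπ2pos
      linarith [mul_comm π2 (c₀ / 2)]
    refine h3.trans (measureReal_mono fun ω (hω : w ≤ f ω) => ?_)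
    exact lt_of_lt_of_le (lt_of_le_of_lt hs hvw) hω
  have hfatg : ∀ t, t ≤ v → c₀ / 2 ≤ P.real {ω | t < g ω} := by
    intro t ht
    have hM := integral_le_add_mul_measureReal_le P hgm hgi hw0 hcapg
    rw [← hτB] at hM
    have h1 : c₀ * π2 - w ≤ π2 * P.real {ω | w ≤ g ω} := by linarith [hG'.2]
    have h2 : c₀ / 2 * π2 ≤ π2 * P.real {ω | w ≤ g ω} := by rw [hw] at h1; linarith
    have h3 : c₀ / 2 ≤ P.real {ω | w ≤ g ω} := by
      by_contra hlt
      push Not at hlt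
      have := mul_lt_mul_of_pos_left hlt hπ2pos
      linarith [mul_comm π2 (c₀ / 2)]
    refine h3.trans (measureReal_mono fun ω (hω : w ≤ g ω) => ?_)
    exact lt_of_lt_of_le (lt_of_le_of_lt ht hvw) hω
  -- upper fatness: for `s > 0`, `{s < f} ⊆ {f = 0}ᶜ`, so `P(s < f) ≤ 1 - c_B`
  have hthinf : ∀ s, 0 < s → P.real {ω | s < f ω} ≤ 1 - cB := by
    intro s hs
    have hmeas0 : MeasurableSet {ω | f ω = 0} := hfm (measurableSet_singleton 0)
    have hsub : {ω | s < f ω} ⊆ {ω | f ω = 0}ᶜ := fun ω (hω : s < f ω) (h0 : f ω = 0) => by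
      rw [h0] at hω; exact absurd hω (not_lt.2 hs.le)
    calc P.real {ω | s < f ω} ≤ P.real {ω | f ω = 0}ᶜ := measureReal_mono hsub
      _ = 1 - P.real {ω | f ω = 0} := probReal_compl_eq_one_sub hmeas0
      _ ≤ 1 - cB := by linarith [hBl'.1]
  have hthing : ∀ t, 0 < t → P.real {ω | t < g ω} ≤ 1 - cB := by
    intro t ht
    have hmeas0 : MeasurableSet {ω | g ω = 0} := hgm (measurableSet_singleton 0)
    have hsub : {ω | t < g ω} ⊆ {ω | g ω = 0}ᶜ := fun ω (hω : t < g ω) (h0 : g ω = 0) => by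
      rw [h0] at hω; exact absurd hω (not_lt.2 ht.le)
    calc P.real {ω | t < g ω} ≤ P.real {ω | g ω = 0}ᶜ := measureReal_mono hsub
      _ = 1 - P.real {ω | g ω = 0} := probReal_compl_eq_one_sub hmeas0
      _ ≤ 1 - cB := by linarith [hBl'.2]
  -- Harris for the level sets (all levels)
  have hHarris : ∀ s t : ℝ, P.real {ω | s < f ω} * P.real {ω | t < g ω} ≤
      P.real ({ω | s < f ω} ∩ {ω | t < g ω}) := fun s t =>
    harris_fkg_holds (zdGraph 3) (criticalProbI 3)
      (isUpperSet_lt_blockCondProb _ _ K hAu s) (isUpperSet_lt_blockCondProb _ _ K hBu t)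
      (measurableSet_lt measurable_const hfm) (measurableSet_lt measurable_const hgm)
  -- the relative gap on the window, from stub_fatGap at fatness `min (c₀/2) c_B`
  have hgap : ∀ s ∈ Set.Icc u v, ∀ t ∈ Set.Icc u v,
      δ' * (P.real {ω | s < f ω} * P.real {ω | t < g ω}) ≤
        P.real ({ω | s < f ω} ∩ {ω | t < g ω}) - P.real {ω | s < f ω} * P.real {ω | t < g ω} := by
    intro s hs t ht
    refine hFG' s t ?_ ?_ ?_ ?_
    · exact (min_le_left _ _).trans (hfatf s hs.2)
    · exact (hthinf s (lt_of_lt_of_le hu0 hs.1)).trans (by linarith [min_le_right (c₀ / 2) cB])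
    · exact (min_le_left _ _).trans (hfatg t ht.2)
    · exact (hthing t (lt_of_lt_of_le hu0 ht.1)).trans (by linarith [min_le_right (c₀ / 2) cB])
  -- covariance slicing
  have hslice := stub_covSlicing P f g hfm hgm hf01 hg01 hHarris δ' u v hu0.le hv1 hgap
  -- the window integrals are at least `c₀² π2 / 16`
  have hWf : c₀ ^ 2 * π2 / 16 ≤ ∫ s in Set.Icc u v, P.real {ω | s < f ω} := by
    have h := mul_sub_le_setIntegral_levelSet P f huv hfatf
    have : c₀ / 2 * (v - u) = c₀ ^ 2 * π2 / 16 := by rw [hu, hv]; ring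
    linarith
  have hWg : c₀ ^ 2 * π2 / 16 ≤ ∫ t in Set.Icc u v, P.real {ω | t < g ω} := by
    have h := mul_sub_le_setIntegral_levelSet P g huv hfatg
    have : c₀ / 2 * (v - u) = c₀ ^ 2 * π2 / 16 := by rw [hu, hv]; ring
    linarith
  -- put everything together: `Cov(f, g) ≥ δ' (c₀² π2 / 16)²`
  have hWpos : 0 ≤ c₀ ^ 2 * π2 / 16 := by positivity
  have hprod : (c₀ ^ 2 * π2 / 16) * (c₀ ^ 2 * π2 / 16) ≤
      (∫ s in Set.Icc u v, P.real {ω | s < f ω}) * (∫ t in Set.Icc u v, P.real {ω | t < g ω}) :=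
    mul_le_mul hWf hWg hWpos (hWpos.trans hWf)
  have hcov : δ' * ((c₀ ^ 2 * π2 / 16) * (c₀ ^ 2 * π2 / 16)) ≤
      ∫ ω, f ω * g ω ∂P - (∫ ω, f ω ∂P) * (∫ ω, g ω ∂P) :=
    calc δ' * ((c₀ ^ 2 * π2 / 16) * (c₀ ^ 2 * π2 / 16))
        ≤ δ' * ((∫ s in Set.Icc u v, P.real {ω | s < f ω}) *
            (∫ t in Set.Icc u v, P.real {ω | t < g ω})) :=
          mul_le_mul_of_nonneg_left hprod hδ'.le
      _ ≤ ∫ ω, f ω * g ω ∂P - (∫ ω, f ω ∂P) * (∫ ω, g ω ∂P) := hslice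
  -- the variance cap: `∫ f² - (∫ f)² ≤ ∫ f² ≤ π2 ∫ f ≤ π2²` (`f ≤ π2` a.e., `0 ≤ f`, `∫ f = τ ≤ π2`)
  have hf2le : ∫ ω, f ω ^ 2 ∂P ≤ π2 * ∫ ω, f ω ∂P := by
    calc ∫ ω, f ω ^ 2 ∂P ≤ ∫ ω, π2 * f ω ∂P :=
          integral_mono_ae hf2i (hfi.const_mul π2) (hcapf.mono fun ω hω => by
            show f ω ^ 2 ≤ π2 * f ω
            rw [sq]
            exact mul_le_mul_of_nonneg_right hω (hf01 ω).1)
      _ = π2 * ∫ ω, f ω ∂P := integral_const_mul _ _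
  have hIle : ∫ ω, f ω ∂P ≤ π2 := by rw [← hτA]; exact hτAle
  have hππ : π2 * ∫ ω, f ω ∂P ≤ π2 * π2 := mul_le_mul_of_nonneg_left hIle hπ2pos.le
  have hVar : ∫ ω, f ω ^ 2 ∂P - (∫ ω, f ω ∂P) ^ 2 ≤ π2 * π2 := by
    nlinarith [hf2le, hππ, sq_nonneg (∫ ω, f ω ∂P)]
  have hstep : δ' * c₀ ^ 4 / 256 * (∫ ω, f ω ^ 2 ∂P - (∫ ω, f ω ∂P) ^ 2) ≤
      δ' * c₀ ^ 4 / 256 * (π2 * π2) :=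
    mul_le_mul_of_nonneg_left hVar (by positivity)
  have heq : δ' * ((c₀ ^ 2 * π2 / 16) * (c₀ ^ 2 * π2 / 16)) = δ' * c₀ ^ 4 / 256 * (π2 * π2) := by ring
  linarith [hcov, hstep, heq]

end Summit.CriticalPhenomena.PercolationContinuityZ3.Theorems.TetrahedronHarrisGap

end
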